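/-
Copyright (c) 2026 the pub-hodgecm-mathlib formalisation cell (harness21).  R90-TF SLAB, section S10 (Rogawski 1990, Ch. 13.5–13.8 comparison engine read at `v`),
prover R90-C138-p03 (g0) — KIT of the A2c payer `Theorems/R90S10FrozenOfUnitTransfer.lean` (road (β-FL)); h413 = `stmt-HodgeConjecture-24833`, route `HCCMUnconditional`.
-/
import Summits.HodgeConjecture.HodgeConjecture.Theorems.K2E1GlobalTestFunctionsBridge   -- ★ `isCompact_restrictedProduct_box`, ★ `PureTensor.toCc`, ★ `toLocal_mem_localIntegralLevel_iff`, ★ `Pl`-free currency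
import Summits.HodgeConjecture.HodgeConjecture.Theorems.K2E1TraceFormulaBetaDefs        -- ★ `Pl` (finite places of `L⁺`, reducible)
import Mathlib.MeasureTheory.Measure.Haar.Unique
import Mathlib.MeasureTheory.Integral.Bochner.Set
import HarnessLib

/-!
# R90-TF ∕ S10 — KIT for the payer of socket A2c `sock_S10_frozenVectors`: box indicators, reductions `∫ F(x, y) χ(y) dν(y)`, Tate-normalised Haar measures on
# restricted products, and frozen pure tensors `a ⊗ ψ ⊗ 𝟙_{K^v}` as members of `C_c(U(H)(𝔸_{L⁺}))`
# (`Theorems/R90S10FrozenVectorKit.lean`; ns `Summit.HodgeConjecture.HodgeConjecture.R90.S10`; generic — no S10 datum; consumer: `Theorems/R90S10FrozenOfUnitTransfer.lean`)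

THEOREMS ONLY (no `def`, no `instance`, no `sorry`; default heartbeats).  Print locus: [Rogawski1990, §13.8 Prop. 13.8.3 (proof) p. 218 L20–L28, p. 219 L1–L2]
(«`f = f_u × f_{v′} × f^{u,v′}`», the unit of a hyperspecial off `v`; the `θ`-reductions of `f^H`); [BorelJacquet1979, §4.1]; [CasselsFrohlich1967, Ch. II §13];
[PlatonovRapinchuk1994, §5.1].
* §0 `finprod_subtype_indicator_eq_ite` — `∏ᶠ_{i : p i} 𝟙_{A_i}(t_i)` IS the indicator of the box `{∀ i, p i → t_i ∈ A_i}` when `t_i ∈ A_i` a.e.;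
  `eventually_slice_eq_of_isLocSmooth` (tube lemma: the slices `F(x′, ·)` of a locally constant compactly supported `F` are literally `F(x, ·)` near `x`),
  `hasCompactSupport_reduce`, `isLocSmooth_reduce` (the reduction `x ↦ ∫ F(x, y) χ(y) dν(y)` is locally smooth for EVERY `χ`, `ν`), and
  `continuous_reduce_of_continuous` (continuity of the reduction of `F ∈ C_c` for `χ` continuous, `ν` locally finite — Mathlib
  `continuous_parametric_integral_of_continuous`; the discharge of the consumer's named input `hredi`).
* §1 `exists_sliceNormalised_haar` — (B4) Tate's normalisation: a left Haar measure `νf` on `Πʳ_i [G_i, K_i]` with `νf(K′ × Π_{i ≠ v} K_i) = νv(K′)` for every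
  compact open `K′ ≤ G_v` (the `v`-slice of a Haar measure is `c · νv` on compacta by Mathlib `measure_isMulInvariant_eq_smul_of_isCompact_closure`).
* §2 `exists_frozenPureTensor` — for `a ∈ C_c(U(H)(L ⊗ ℝ))` and `ψ ∈ C_c^∞(U(H)(L⁺_v))` there is `Φ ∈ C_c(U(H)(𝔸_{L⁺}))` with the POINTWISE pin
  `Φ(g) = a(g_∞) · ψ(g_v) · ∏ᶠ_{w ≠ v} 𝟙_{U(H)(𝒪_w)}(g_w)` (★ `UnitaryGroup.PureTensor.toCc` with bad set `{v}` + §0), stated on the generic datum ★ `adelicGroupData L⁺ L c N H`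
  (= ★ `cmDatum L N H`, ★ `adelicGroupData_eq_cmDatum`) as the S10 structures read it.
HONEST LABEL: generic bookkeeping; closes nothing; HC_CM is proved only modulo the 7 printed citations (2 remaining named inputs: hLiu418 = `stmt-HodgeConjecture-24832`,
h413 = `stmt-HodgeConjecture-24833`) until rung 0 closes.
-/

set_option autoImplicit false
set_option linter.dupNamespace false

noncomputable section

open scoped RestrictedProduct NNReal ENNReal
open Filter MeasureTheory Measure NumberField IsDedekindDomain CompactlySupported Topology Set
open Literature.NumberTheory.Rogawski1990 Literature.NumberTheory.Automorphic Literature.NumberTheory.Automorphic.UnitaryGroup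
open Summit.HodgeConjecture.HodgeConjecture.Cruxes.H413.K2E1TraceFormulaBeta (Pl)
open Summit.HodgeConjecture.HodgeConjecture.Cruxes.H413.K2E1GlobalTestFunctions (isCompact_restrictedProduct_box)

namespace Summit.HodgeConjecture.HodgeConjecture.R90.S10

/-! ## §0 Generic kit: the box indicator as a `finprod`, uniform local constancy of compactly supported slices, reductions -/

section Kit

/-- **The `finprod` of unit indicators over the places `≠ v` IS the indicator of the box**: if `t i ∈ A i` for all but finitely many `i`, then
`∏ᶠ_{i : p i} 𝟙_{A i}(t i) = 1` when `t i ∈ A i` for every `i` with `p i`, and `= 0` otherwise (a genuinely finite product). [folklore]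
[cite: BorelJacquet1979, §4.1] -/
theorem finprod_subtype_indicator_eq_ite {ι : Type*} {R : ι → Type*} (p : ι → Prop) (A : ∀ i, Set (R i)) (t : ∀ i, R i)
    (h : ∀ᶠ i in cofinite, t i ∈ A i) [Decidable (∀ i, p i → t i ∈ A i)] :
    (∏ᶠ i : {i : ι // p i}, (A i.1).indicator (fun _ => (1 : ℂ)) (t i.1)) = if ∀ i, p i → t i ∈ A i then 1 else 0 := by
  split_ifs with hall
  · exact finprod_eq_one_of_forall_eq_one fun i => Set.indicator_of_mem (hall i.1 i.2) _
  · obtain ⟨i, hpi, hi⟩ : ∃ i, p i ∧ t i ∉ A i := by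
      by_contra hcon
      exact hall fun i hp => not_not.1 fun hn => hcon ⟨i, hp, hn⟩
    refine finprod_eq_zero _ ⟨i, hpi⟩ (Set.indicator_of_notMem hi _) ?_
    refine ((Filter.eventually_cofinite.1 h).preimage (Subtype.val_injective.injOn)).subset fun j hj => ?_
    intro hmem
    exact hj (Set.indicator_of_mem hmem _)

variable {X Y : Type*} [TopologicalSpace X] [TopologicalSpace Y]

/-- **Uniform local constancy of the slices of a locally constant compactly supported function of two variables** (tube lemma): if
`F : X × Y → ℂ` is locally constant with compact support then near every `x` the SLICE FUNCTIONS `F(x′, ·)` and `F(x, ·)` coincide.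
[folklore] [cite: Rogawski1990, §1.6 p. 6] -/
theorem eventually_slice_eq_of_isLocSmooth {F : X × Y → ℂ} (hF : IsLocSmooth F) (x : X) :
    ∀ᶠ x' in 𝓝 x, (fun y => F (x', y)) = fun y => F (x, y) := by
  classical
  -- local constancy at each `(x, y)`: product neighbourhoods on which `F` is constant
  have hloc : ∀ y : Y, ∃ V ∈ 𝓝 x, ∃ W ∈ 𝓝 y, ∀ x' ∈ V, ∀ y' ∈ W, F (x', y') = F (x, y) := by
    intro y
    have h := (IsLocallyConstant.iff_eventually_eq F).1 hF.1 (x, y)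
    obtain ⟨V, hV, W, hW, hVW⟩ := mem_nhds_prod_iff.1 h
    exact ⟨V, hV, W, hW, fun x' hx' y' hy' => hVW (Set.mk_mem_prod hx' hy')⟩
  choose V hV W hW hVW using hloc
  -- the compact projection of the support
  set K : Set Y := Prod.snd '' tsupport F with hK
  have hKc : IsCompact K := hF.2.image continuous_snd
  obtain ⟨T, -, hTK⟩ := hKc.elim_nhds_subcover W fun y _ => hW y
  have hVx : (⋂ y ∈ T, V y) ∈ 𝓝 x := (Filter.biInter_finset_mem T).2 fun y _ => hV y
  filter_upwards [hVx] with x' hx'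
  funext y
  by_cases hy : y ∈ K
  · obtain ⟨y₀, hy₀T, hyW⟩ : ∃ y₀ ∈ T, y ∈ W y₀ := by
      have := hTK hy
      simp only [Set.mem_iUnion, exists_prop] at this
      exact this
    have hx'V : x' ∈ V y₀ := (Set.mem_iInter₂.1 hx') y₀ hy₀T
    rw [hVW y₀ x' hx'V y hyW, hVW y₀ x (mem_of_mem_nhds (hV y₀)) y hyW]
  · -- off `K` both slices vanish
    have h0 : ∀ x'' : X, F (x'', y) = 0 := fun x'' => by
      by_contra hne
      exact hy ⟨(x'', y), subset_tsupport _ hne, rfl⟩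
    rw [h0 x', h0 x]

/-- **Off the first projection of the support every slice vanishes.** [folklore] -/
theorem slice_eq_zero_of_notMem_image_fst {F : X × Y → ℂ} {x : X} (hx : x ∉ Prod.fst '' tsupport F) (y : Y) : F (x, y) = 0 := by
  by_contra hne
  exact hx ⟨(x, y), subset_tsupport _ hne, rfl⟩

/-- **A reduction `x ↦ ∫ F(x, y) χ(y) dν(y)` of a compactly supported `F` has compact support** — contained in the first projection of `tsupport F`;
NO regularity of `χ`, `ν` is needed. [folklore] [cite: Rogawski1990, §13.8 p. 219 L1–L2] -/
theorem hasCompactSupport_reduce [T2Space X] [MeasurableSpace Y] {F : X × Y → ℂ} (hF : HasCompactSupport F) (χ : Y → ℂ) (ν : Measure Y) :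
    HasCompactSupport fun x => ∫ y, F (x, y) * χ y ∂ν := by
  refine HasCompactSupport.intro (hF.image continuous_fst) fun x hx => ?_
  simp only [slice_eq_zero_of_notMem_image_fst hx, zero_mul, integral_zero]

/-- **The `θ_v`-reduction of a locally smooth function is locally smooth, for EVERY `χ`, `ν`**: `h₂ ↦ ∫ f^H(h₂, z) χ(z) dν(z)` is locally constant (the
slices `f^H(h₂′, ·)` are literally equal near `h₂`, `eventually_slice_eq_of_isLocSmooth`) with compact support (`hasCompactSupport_reduce`).
[cite: Rogawski1990, §13.8 p. 219 L1–L2; §1.6 p. 6] -/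
theorem isLocSmooth_reduce [T2Space X] [MeasurableSpace Y] {F : X × Y → ℂ} (hF : IsLocSmooth F) (χ : Y → ℂ) (ν : Measure Y) :
    IsLocSmooth fun x => ∫ y, F (x, y) * χ y ∂ν := by
  refine ⟨(IsLocallyConstant.iff_eventually_eq _).2 fun x => ?_, hasCompactSupport_reduce hF.2 χ ν⟩
  filter_upwards [eventually_slice_eq_of_isLocSmooth hF x] with x' hx'
  simp only [show ∀ y, F (x', y) = F (x, y) from fun y => congrFun hx' y]

/-- **Continuity of a reduction under regularity**: for `F ∈ C_c(X × Y)`, `χ` CONTINUOUS and `ν` locally finite, `x ↦ ∫ F(x, y) χ(y) dν(y)` is continuous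
(Mathlib `continuous_parametric_integral_of_continuous` on the compact `snd '' tsupport F`).  This is the discharge of the named input `hredi` of
`frozen_of_unitTransfer` as soon as `θ_∞` is recorded continuous and `dz` locally finite. [folklore] [cite: Rogawski1990, §13.8 p. 219 L1–L2] -/
theorem continuous_reduce_of_continuous [FirstCountableTopology X] [LocallyCompactSpace X] [MeasurableSpace Y] [OpensMeasurableSpace Y]
    [SecondCountableTopologyEither Y ℂ] (F : C_c(X × Y, ℂ)) {χ : Y → ℂ} (hχ : Continuous χ) (ν : Measure Y) [IsLocallyFiniteMeasure ν] :
    Continuous fun x => ∫ y, F (x, y) * χ y ∂ν := by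
  set s : Set Y := Prod.snd '' tsupport (⇑F) with hs
  have hsc : IsCompact s := F.hasCompactSupport.image continuous_snd
  have hcont : Continuous (Function.uncurry fun x y => F (x, y) * χ y) :=
    F.continuous.mul (hχ.comp continuous_snd)
  have h := continuous_parametric_integral_of_continuous (μ := ν) hcont hsc
  refine h.congr fun x => ?_
  refine setIntegral_eq_integral_of_forall_compl_eq_zero fun y hy => ?_
  have : F (x, y) = 0 := by
    by_contra hne
    exact hy ⟨(x, y), subset_tsupport _ hne, rfl⟩
  rw [this, zero_mul]

end Kit

/-! ## §1 (B4) Tate's normalisation: a left Haar measure on `Πʳ_i [G_i, K_i]` whose `v`-slice on the unit box is a GIVEN Haar measure of `G_v` -/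

section Tate

variable {ι : Type*} {G : ι → Type*} [∀ i, Group (G i)] [∀ i, TopologicalSpace (G i)] [∀ i, IsTopologicalGroup (G i)]
  (K : ∀ i, Subgroup (G i)) [hKo : Fact (∀ i, IsOpen (K i : Set (G i)))]

/-- **TATE-NORMALISED HAAR MEASURE ON A RESTRICTED PRODUCT SLICE.**  Let `G_i` be topological groups with compact open subgroups `K_i`, `v` an index,
`νv` a Haar measure on the locally compact `G_v`.  There is a left-invariant measure `νf`, finite on compacta, on the restricted product `Πʳ_i [G_i, K_i]`
such that `νf {g | g_v ∈ K′, g_i ∈ K_i (i ≠ v)} = νv(K′)` for EVERY compact open subgroup `K′ ≤ G_v` — the normalisation (B4) of ★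
`flath_conjuncts_of_inputs_of_locSmooth` ∕ field `S10Frozen.hνf`.  Proof: the `v`-slice `K′ ↦ haar{…}` of a Haar measure of the restricted product is left
invariant (translation by ★ `RestrictedProduct.mulSingle v x` moves only the `v`-coordinate) and finite on compacta (★ box lemma), so it is `c · νv` on
compacta (Mathlib `measure_isMulInvariant_eq_smul_of_isCompact_closure`) with `c ≠ 0` (the unit box is open and non-empty); take `νf := c⁻¹ · haar`.
[cite: CasselsFrohlich1967, Ch. II §13] [cite: PlatonovRapinchuk1994, §5.1] -/
theorem exists_sliceNormalised_haar [DecidableEq ι] (hKc : ∀ i, IsCompact (K i : Set (G i))) (v : ι)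
    [MeasurableSpace (G v)] [BorelSpace (G v)] [LocallyCompactSpace (G v)] (νv : Measure (G v)) [νv.IsHaarMeasure]
    [MeasurableSpace (Πʳ i, [G i, K i])] [BorelSpace (Πʳ i, [G i, K i])] :
    ∃ νf : Measure (Πʳ i, [G i, K i]), νf.IsMulLeftInvariant ∧ IsFiniteMeasureOnCompacts νf ∧
      ∀ K' : Subgroup (G v), IsOpen (K' : Set (G v)) → IsCompact (K' : Set (G v)) →
        νf.real {g : Πʳ i, [G i, K i] | g v ∈ K' ∧ ∀ i, i ≠ v → g i ∈ K i} = νv.real (K' : Set (G v)) := by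
  classical
  haveI : ∀ i, CompactSpace (K i) := fun i => isCompact_iff_compactSpace.1 (hKc i)
  -- the Haar measure of the restricted product and its `v`-slice on the unit box
  set η : Measure (Πʳ i, [G i, K i]) := Measure.haar with hη
  have hmeas : Measurable fun g : Πʳ i, [G i, K i] => g v := (RestrictedProduct.continuous_eval v).measurable
  set U : Set (Πʳ i, [G i, K i]) := {g | ∀ i, i ≠ v → g i ∈ K i} with hU
  have hUo : IsOpen U := RestrictedProduct.isOpen_forall_imp_mem (fun i => hKo.out i) (p := fun i => i ≠ v)
  have hbox : ∀ s : Set (G v), {g : Πʳ i, [G i, K i] | g v ∈ s ∧ ∀ i, i ≠ v → g i ∈ K i} = (fun g => g v) ⁻¹' s ∩ U := by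
    intro s; ext g; simp only [hU, Set.mem_setOf_eq, Set.mem_inter_iff, Set.mem_preimage]
  set ν₀ : Measure (G v) := (η.restrict U).map fun g => g v with hν₀
  have hν₀_apply : ∀ s : Set (G v), MeasurableSet s → ν₀ s = η {g | g v ∈ s ∧ ∀ i, i ≠ v → g i ∈ K i} := by
    intro s hs
    rw [hν₀, Measure.map_apply hmeas hs, Measure.restrict_apply (hmeas hs), hbox]
  -- compact boxes are compact (★ box lemma), so the slice is finite on compacta
  have hboxc : ∀ s : Set (G v), IsCompact s → IsCompact {g : Πʳ i, [G i, K i] | g v ∈ s ∧ ∀ i, i ≠ v → g i ∈ K i} := by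
    intro s hs
    have hB := isCompact_restrictedProduct_box (A := fun i => (K i : Set (G i)))
      (Function.update (fun i => (K i : Set (G i))) v s) (fun i => by
        by_cases h : i = v
        · subst h; rw [Function.update_self]; exact hs
        · rw [Function.update_of_ne h]; exact hKc i)
      (by
        filter_upwards [(Set.finite_singleton v).compl_mem_cofinite] with i hi
        rw [Function.update_of_ne (by simpa using hi)])
    convert hB using 1
    ext g
    simp only [Set.mem_setOf_eq]
    constructor
    · rintro ⟨hgv, hg⟩ i
      by_cases h : i = v
      · subst h; rw [Function.update_self]; exact hgv
      · rw [Function.update_of_ne h]; exact hg i h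
    · intro hg
      refine ⟨by simpa only [Function.update_self] using hg v, fun i hi => ?_⟩
      simpa only [Function.update_of_ne hi, SetLike.mem_coe] using hg i
  -- the slice is left invariant: translate by the element supported at `v`
  haveI hν₀l : ν₀.IsMulLeftInvariant := by
    refine ⟨fun x => Measure.ext fun s hs => ?_⟩
    rw [Measure.map_apply (measurable_const_mul x) hs, hν₀_apply _ (measurable_const_mul x hs), hν₀_apply s hs]
    have hpre : {g : Πʳ i, [G i, K i] | g v ∈ (fun y => x * y) ⁻¹' s ∧ ∀ i, i ≠ v → g i ∈ K i} =
        (fun g => RestrictedProduct.mulSingle K v x * g) ⁻¹' {g | g v ∈ s ∧ ∀ i, i ≠ v → g i ∈ K i} := by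
      ext g
      simp only [Set.mem_setOf_eq, Set.mem_preimage, RestrictedProduct.mul_apply, RestrictedProduct.mulSingle_eq_same]
      refine and_congr Iff.rfl (forall₂_congr fun i hi => ?_)
      rw [RestrictedProduct.mulSingle_eq_of_ne K x hi, one_mul]
    rw [hpre, measure_preimage_mul]
  -- … and finite on compacta
  haveI hν₀c : IsFiniteMeasureOnCompacts ν₀ := by
    refine ⟨fun s hs => ?_⟩
    calc ν₀ s ≤ ν₀ (closure s) := measure_mono subset_closure
      _ = η {g | g v ∈ closure s ∧ ∀ i, i ≠ v → g i ∈ K i} := hν₀_apply _ isClosed_closure.measurableSet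
      _ < ⊤ := (hboxc _ hs.closure).measure_lt_top
  -- Haar comparison on compacta: `ν₀ = c · νv` there
  set c : ℝ≥0 := haarScalarFactor ν₀ νv with hc
  have hcmp : ∀ K' : Subgroup (G v), IsOpen (K' : Set (G v)) → IsCompact (K' : Set (G v)) →
      η {g : Πʳ i, [G i, K i] | g v ∈ (K' : Set (G v)) ∧ ∀ i, i ≠ v → g i ∈ K i} = c • νv (K' : Set (G v)) := by
    intro K' hK'o hK'c
    rw [← hν₀_apply _ hK'o.measurableSet]
    exact measure_isMulInvariant_eq_smul_of_isCompact_closure ν₀ νv hK'c.closure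
  -- `c ≠ 0`: the unit box is open and non-empty, hence of positive Haar measure
  have hc0 : c ≠ 0 := by
    intro h0
    have h1 := hcmp (K v) (hKo.out v) (hKc v)
    rw [h0, zero_smul] at h1
    have hopen : IsOpen {g : Πʳ i, [G i, K i] | g v ∈ (K v : Set (G v)) ∧ ∀ i, i ≠ v → g i ∈ K i} := by
      rw [hbox]; exact ((hKo.out v).preimage (RestrictedProduct.continuous_eval v)).inter hUo
    have hne : ({g : Πʳ i, [G i, K i] | g v ∈ (K v : Set (G v)) ∧ ∀ i, i ≠ v → g i ∈ K i}).Nonempty :=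
      ⟨1, by
        simp only [Set.mem_setOf_eq, RestrictedProduct.one_apply, SetLike.mem_coe]
        exact ⟨one_mem _, fun i _ => one_mem _⟩⟩
    exact (hopen.measure_pos η hne).ne' h1
  refine ⟨c⁻¹ • η, inferInstance, inferInstance, fun K' hK'o hK'c => ?_⟩
  change (c⁻¹ • η).real {g : Πʳ i, [G i, K i] | g v ∈ (K' : Set (G v)) ∧ ∀ i, i ≠ v → g i ∈ K i} = _
  rw [measureReal_def, measureReal_def, Measure.smul_apply, hcmp K' hK'o hK'c, smul_smul, inv_mul_cancel₀ hc0, one_smul]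

end Tate

/-! ## §2 Frozen pure tensors `a ⊗ ψ ⊗ 𝟙_{K^v}` as members of `C_c(U(H)(𝔸_{L⁺}))`, pinned pointwise -/

section Freeze

variable (L : Type) [Field L] [NumberField L] [IsCMField L] [DecidableEq (Pl L)] (N : ℕ) (H : Matrix (Fin N) (Fin N) L) (v : Pl L)

/-- **FROZEN PURE TENSOR**: for an archimedean factor `a ∈ C_c(U(H)(L ⊗ ℝ))` and a locally smooth `ψ` on `U(H)(L⁺_v)` there is `Φ ∈ C_c(U(H)(𝔸_{L⁺}))` with
`Φ(g) = a(g_∞) · ψ(g_v) · ∏ᶠ_{w ≠ v} 𝟙_{U(H)(𝒪_w)}(g_w)` for EVERY `g` — ★ `UnitaryGroup.PureTensor.toCc` (bad set `{v}`, integral levels ★ `cmLocalIntegralLevel`) + ★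
`PureTensor.eval_eq_of_forall_mem` ∕ `eval_eq_zero_of_not_mem` + `finprod_subtype_indicator_eq_ite` (almost all components are integral, ★ `eventually_evalPlace_mem_localInt`,
★ `toLocal_mem_localIntegralLevel_iff`).  Stated over ★ `adelicGroupData L⁺ L c N H` («`f = f_∞ ⊗ f_v ⊗ f^{v}`, `f^{v}` the unit», p. 218 L24, p. 219 L2).
[cite: Rogawski1990, §13.8 p. 218 L24, p. 219 L2; §14.2 p. 233] [cite: BorelJacquet1979, §4.1] -/
theorem exists_frozenPureTensor (a : UnitaryGroup.arch (↥(maximalRealSubfield L)) L (IsCMField.complexConj L) N H → ℂ) (ha : Continuous a)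
    (ha' : HasCompactSupport a) (ψ : (UnitaryGroup.cmDatum L N H).Local v → ℂ) (hψ : IsLocSmooth ψ) :
    ∃ Φ : C_c((adelicGroupData (↥(maximalRealSubfield L)) L (IsCMField.complexConj L) N H).Adelic, ℂ),
      ∀ g : (adelicGroupData (↥(maximalRealSubfield L)) L (IsCMField.complexConj L) N H).Adelic,
        Φ g = a (UnitaryGroup.archPart (↥(maximalRealSubfield L)) L (IsCMField.complexConj L) N H g) *
          (ψ ((adelicGroupData (↥(maximalRealSubfield L)) L (IsCMField.complexConj L) N H).toLocal v g) *
            ∏ᶠ w : {w : Pl L // w ≠ v}, Set.indicator (cmLocalIntegralLevel L N H w.1 : Set ((UnitaryGroup.cmDatum L N H).Local w.1)) (fun _ => (1 : ℂ))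
              ((adelicGroupData (↥(maximalRealSubfield L)) L (IsCMField.complexConj L) N H).toLocal w.1 g)) := by
  classical
  let T : UnitaryGroup.PureTensor L N H :=
    { S := {v}
      K := fun w => cmLocalIntegralLevel L N H w
      loc := Function.update (β := fun w : Pl L => (UnitaryGroup.cmDatum L N H).Local w → ℂ)
        (fun w : Pl L => (cmLocalIntegralLevel L N H w : Set ((UnitaryGroup.cmDatum L N H).Local w)).indicator fun _ => (1 : ℂ)) v ψ
      arch := a
      loc_eq_indicator := fun w hw => by
        rw [Function.update_of_ne (fun h => hw (Finset.mem_singleton.2 h))] }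
  have hK : ∀ w ∉ T.S, T.K w = cmLocalIntegralLevel L N H w := fun _ _ => rfl
  have hv : T.loc v = ψ := by simp only [T, Function.update_self]
  have hc : ∀ w ∈ T.S, Continuous (T.loc w) := by
    intro w hw
    rw [Finset.mem_singleton.1 hw, hv]
    exact hψ.continuous
  have hs : ∀ w ∈ T.S, HasCompactSupport (T.loc w) := by
    intro w hw
    rw [Finset.mem_singleton.1 hw, hv]
    exact hψ.hasCompactSupport
  refine ⟨T.toCc hK ha ha' hc hs, fun g => ?_⟩
  have hev : ∀ᶠ w in cofinite, (adelicGroupData (↥(maximalRealSubfield L)) L (IsCMField.complexConj L) N H).toLocal w g ∈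
      (cmLocalIntegralLevel L N H w : Set ((UnitaryGroup.cmDatum L N H).Local w)) := by
    filter_upwards [eventually_evalPlace_mem_localInt (↥(maximalRealSubfield L)) L (IsCMField.complexConj L) N H
      (finPart (↥(maximalRealSubfield L)) L (IsCMField.complexConj L) N H g)] with w hw
    exact (toLocal_mem_localIntegralLevel_iff (↥(maximalRealSubfield L)) L (IsCMField.complexConj L) N H w g).2 hw
  have hfin := finprod_subtype_indicator_eq_ite (R := fun w : Pl L => (UnitaryGroup.cmDatum L N H).Local w) (fun w => w ≠ v)
    (fun w => (cmLocalIntegralLevel L N H w : Set ((UnitaryGroup.cmDatum L N H).Local w)))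
    (fun w => (adelicGroupData (↥(maximalRealSubfield L)) L (IsCMField.complexConj L) N H).toLocal w g) hev
  have happ : T.toCc hK ha ha' hc hs g = T.eval g := UnitaryGroup.PureTensor.toCc_apply _ _ _ _ _ _ _
  by_cases hall : ∀ w, w ≠ v → (adelicGroupData (↥(maximalRealSubfield L)) L (IsCMField.complexConj L) N H).toLocal w g ∈
      (cmLocalIntegralLevel L N H w : Set ((UnitaryGroup.cmDatum L N H).Local w))
  · -- on the box: `eval g = a(g_∞) · ψ(g_v)` and the unit `finprod` is `1`
    have hall' : ∀ w ∉ T.S, (UnitaryGroup.cmDatum L N H).toLocal w g ∈ T.K w :=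
      fun w hw => hall w (fun h => hw (Finset.mem_singleton.2 h))
    have heval : T.eval g = a (UnitaryGroup.archPart (↥(maximalRealSubfield L)) L (IsCMField.complexConj L) N H g) *
        ψ ((adelicGroupData (↥(maximalRealSubfield L)) L (IsCMField.complexConj L) N H).toLocal v g) := by
      rw [UnitaryGroup.PureTensor.eval_eq_of_forall_mem T g hall']
      change a (UnitaryGroup.archPart (↥(maximalRealSubfield L)) L (IsCMField.complexConj L) N H g) *
        ∏ w ∈ ({v} : Finset (Pl L)), T.loc w ((adelicGroupData (↥(maximalRealSubfield L)) L (IsCMField.complexConj L) N H).toLocal w g) = _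
      rw [Finset.prod_singleton, hv]
    rw [hfin.trans (if_pos hall), mul_one]
    exact happ.trans heval
  · -- off the box: both sides vanish
    obtain ⟨w, hw, hwK⟩ : ∃ w, w ≠ v ∧ (adelicGroupData (↥(maximalRealSubfield L)) L (IsCMField.complexConj L) N H).toLocal w g ∉
        (cmLocalIntegralLevel L N H w : Set ((UnitaryGroup.cmDatum L N H).Local w)) := by
      by_contra hcon
      exact hall fun w hw => not_not.1 fun hn => hcon ⟨w, hw, hn⟩
    have heval : T.eval g = 0 :=
      UnitaryGroup.PureTensor.eval_eq_zero_of_not_mem T g (v := w) (fun h => hw (Finset.mem_singleton.1 h)) hwK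
    rw [hfin.trans (if_neg hall), mul_zero, mul_zero]
    exact happ.trans heval

end Freeze

end Summit.HodgeConjecture.HodgeConjecture.R90.S10

end
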